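import Literature.MathematicalPhysics.QuantumFieldTheory.Balaban1983to89.B9Eq325ProjFormula
import Literature.MathematicalPhysics.QuantumFieldTheory.Balaban1983to89.B9Eq386ResolventLetters
import Literature.MathematicalPhysics.QuantumFieldTheory.Balaban1983to89.B9Eq319QprimeLipschitzTwoBackgrounds

/-!
# `Balaban1983to89.B9Eq325RLipschitzResolvent` — T. Bałaban, *Propagators for lattice gauge theories in a background field*, Commun. Math. Phys.
# **99** (1985) 389–434 [Balaban1985BackgroundPropagators] p. 403 with (3.25) p. 394: **«THE OPERATORS R(U), P(U) = I − R(U) … SATISFY THE SAME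
# BOUNDS» — THE GAUGE-FIXING PROJECTIONS OF TWO BACKGROUNDS ARE CLOSE IN `L²` OPERATOR NORM, ASSEMBLED THROUGH THE RESOLVENT FORMULA (3.25)
# FROM FIVE DISPLAYED LETTERS** (coercivity `γ` of `Δ′_a`, `‖G′₁ − G′₂‖ ≤ θ_G`, `‖Q′‖ ≤ M_Q`, `‖Q′₁ − Q′₂‖ ≤ θ_Q`, coercivity `κ` of `Q′G′²Q′†`), with
# an explicit constant — sub-step S3d of route R2′ STEP B7′, at the pub-balaban NE9 chain's `R(U)` via `B9Eq325ProjFormula.RofU_eq_formula`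

statement-level skeleton of published theorems with citation tags; proofs where landed; nothing here is a claim about the Yang–Mills mass gap

CITATION HEADER (lean-in-tree rule).  Audit cell `pub-balaban`, sub-cell `t4`, BINDER row NE9; filed by NE9 formalisation-swarm leaf prover 06
(`b2b-balaban-t4-ne9-formalise-leaf-06`, gen 63) as sub-step S3d of route R2′ STEP B7′ (`t4/ROUTES-NE9.md` v13.19 l.407).  Source READ in the
held text: [Balaban1985BackgroundPropagators] pp. 394, 402–403 (`paper:balaban1985-cmp99-background-propagators`, journal page = PDF page + 388).

THE PRINT (verbatim).  p. 394 (3.25): *«Rf = (I − G′Q′*(Q′G′²Q′*)⁻¹Q′G′)f, where G′ = G′(U) = (Δ′_a)⁻¹.»*  p. 403, after (3.63)–(3.68) (`G′(U′U) =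
G′(U)(I − V′(A)G′(U))⁻¹`, `(Q′G′(U′U)²Q′*)⁻¹`): *«These results imply that the operators R(U), P(U) = I − R(U) extend analytically to the domain
(3.37) and satisfy the same bounds.»*

WHY (route R2′ STEP B7′, sub-step S3d «assemble (3.25): ‖R_U − R_1‖ ≤ C_R♯·α»).  Every factor of (3.25) is a letter the route supplies
separately and η-free: the coercivity `γ` of `Δ′_a(U)` and the resolvent difference `‖G′_U − G′_1‖ ≤ θ_G` (S3b, form-relative), the averaging
letters `‖Q̃′‖ ≤ M_Q`, `‖Q̃′_U − Q̃′_1‖ ≤ θ_Q` in the weight-`c₁` currency (leaf-03's (ρ′)∕(ρ′)₂ read into the unit-lattice carrier), and a LOWER bound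
`κ` for `Q′G′²Q′†` (S3c, variational — NOT from `‖Δ′_a‖`, which carries `η⁻²`).  This file is the pure TELESCOPING that turns the five letters into
`‖R₁f − R₂f‖ ≤ C_R♯‖f‖` with `C_R♯` an explicit polynomial in `(γ⁻¹, M_Q, κ⁻¹)` linear in `(θ_G, θ_Q)` — no letter is derived from an operator
norm of `Δ′_a` — and reads it at the chain's `RofU` through `B9Eq325ProjFormula.RofU_eq_formula` (S3a).

WHAT IS PROVED (sorry-free; proof lane — no `def`, no `Prop` placeholder, nothing of [B9] asserted hypothesis-free).
* §1 (abstract, normed spaces over `RCLike 𝕜`): `norm_comp_le'`, **`norm_comp_sub_comp_le`** — the composition rule for pairs of operators with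
  displayed bounds and displayed differences (`(a, da) ∘ (b, db) ↦ (ab, a·db + da·b)`).
* §2 (abstract, finite-dimensional inner-product spaces `E`, `F`; `G′_i := greenK Δ′_i`, `K′_i := Q′_iG′_i²Q′_i†`, `c_i := greenK K′_i`):
  `norm_Kp_sub_Kp_le` (`‖K′₁ − K′₂‖ ≤ δ_K := 2M_Q·(γ⁻²θ_Q + γ⁻¹M_Qθ_G)`), `norm_cinv_le` (`‖c_i‖ ≤ κ⁻¹`), `norm_cinv_sub_cinv_le` (`‖c₁ − c₂‖ ≤ κ⁻¹δ_Kκ⁻¹`),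
  **`norm_R_sub_R_le`**: `‖(f − G′₁Q′₁†c₁Q′₁G′₁f) − (f − G′₂Q′₂†c₂Q′₂G′₂f)‖ ≤ C_R♯·‖f‖`,
  `C_R♯ = γ⁻¹M_Q(κ⁻¹·d₃ + κ⁻¹δ_Kκ⁻¹·M_Qγ⁻¹) + … ` (displayed closed form in the statement; first order in `θ_G`, `θ_Q`).
* §3 (the chain): **`norm_RofU_sub_RofU_le`** — for two backgrounds `U₁`, `U₂` with mutually adjoint transporters and positive `Δ′_a(U_i)`
  (letters `hRS_i`, `hpos′_i` of `B9Eq325ProjFormula`), `‖R(U₁)f − R(U₂)f‖ ≤ C_R♯·‖f‖` from the five displayed letters, by `RofU_eq_formula` twice and §2.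
* §4 (two letters instantiated in the weight-`c₁` currency): **`norm_Qtilde_sub_Qtilde_le`** — `θ_Q = ρ′₂·√(c₁∕(L^dc₀))` from NE9 leaf-03's
  Hilbert-currency (ρ′)₂ (`B9Eq319QprimeLipschitzTwoBackgrounds.sum_norm_sq_QprimeW_sub_QprimeW_le`); **`norm_Qtilde_one_le`** — the flat
  `M_Q(1) = √(c₁∕(L^dc₀))` (block means, Jensen) and **`norm_Qtilde_le`** — `M_Q(U) = (1 + d(L−1)ε(1+ε)^{d(L−1)})·√(c₁∕(L^dc₀))` for
  transporters `ε`-close to the identity; all `(ηL)⁻¹`-sized under the canonical weights `c₁(ηL)² = c₀L^d` — no `√(L^d)` (so of the five letters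
  only `γ`, `θ_G` (S3b) and `κ` (S3c) remain displayed).
HONEST SCOPE.  [folklore] operator-norm telescoping (five factors) at displayed letters; the letters themselves (S3b: `γ`, `θ_G`; S3c: `κ`; (ρ′): `M_Q`,
`θ_Q`) are NOT proved here and their η-freeness is the route's claim, not this file's; ONE sub-step (S3d) of a route step, NOT NE9 (cell pub-balaban:
NE9 NOT PRINTED ∕ NOT PROVED; spine PROVED 0∕9; rung (B)+1 on a finite T⁴ — NOT infinite volume, NOT mass gap, NOT Clay).  NEW file; nothing modified.
Net new unproved facts: 0.
-/

noncomputable section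

open scoped InnerProductSpace ComplexConjugate BigOperators

namespace Literature.MathematicalPhysics.QuantumFieldTheory.Balaban1983to89.B9Eq325RLipschitzResolvent

open B4Sect5Torus (TSite)
open B9SectCLatticeCarrier (Bond)
open B9Eq311L2Pairing (WL2)
open B9Eq319QprimeTorus (fineP)
open B11Eq103H1Complex (SiteL2K greenK apply_greenK greenK_apply)
open B9Eq310HessianOperator (adTransportW)
open B5Eq172HodgePositivity (adTransportW_one)
open B9Eq326OperatorAssembly (QprimeW RofU)
open B9Eq3119DeltaPiCarrier (laplacePrimeA GpOfU)
open B9Eq373DerivativeRemainderL2 (norm_adjoint_apply_le)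
open B9Eq3126GreenLetters (norm_greenK_le)
open B9Eq386ResolventLetters (norm_greenK_sub_greenK_le norm_adjoint_sub_le)
open B9Eq325ProjFormula (QGGQ_pos RofU_eq_formula)
open B9Eq319QprimeLipschitzTwoBackgrounds (sum_norm_sq_QprimeW_sub_QprimeW_le rho₂_nonneg)
open B9Eq319QprimeLipschitz (QprimeW_one_apply blockMean_norm_sq_le sum_blockOf_sum)

/-! ## §1 The composition rule for operators with displayed bounds and differences -/

section Comp

variable {𝕜 : Type*} [RCLike 𝕜] {X Y Z : Type*} [NormedAddCommGroup X] [NormedSpace 𝕜 X] [NormedAddCommGroup Y] [NormedSpace 𝕜 Y]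
  [NormedAddCommGroup Z] [NormedSpace 𝕜 Z]

/-- Composition of displayed bounds: `‖A(Bx)‖ ≤ a·b·‖x‖`. [folklore] [cite: Balaban1985BackgroundPropagators, p.403] -/
theorem norm_comp_le' (A : Y →ₗ[𝕜] Z) (B : X →ₗ[𝕜] Y) {a b : ℝ} (ha : 0 ≤ a) (hA : ∀ y, ‖A y‖ ≤ a * ‖y‖) (hB : ∀ x, ‖B x‖ ≤ b * ‖x‖)
    (x : X) : ‖A (B x)‖ ≤ a * b * ‖x‖ :=
  (hA _).trans (by rw [mul_assoc]; exact mul_le_mul_of_nonneg_left (hB x) ha)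

/-- **THE COMPOSITION RULE FOR DIFFERENCES**: `A₁B₁x − A₂B₂x = A₁(B₁x − B₂x) + (A₁ − A₂)(B₂x)`, so `‖A₁B₁x − A₂B₂x‖ ≤ (a·db + da·b)·‖x‖` from
`‖A₁‖ ≤ a`, `‖A₁ − A₂‖ ≤ da`, `‖B₂‖ ≤ b`, `‖B₁ − B₂‖ ≤ db` — the telescoping step of p. 403's «satisfy the same bounds». [folklore] [cite: Balaban1985BackgroundPropagators, p.403] -/
theorem norm_comp_sub_comp_le (A₁ A₂ : Y →ₗ[𝕜] Z) (B₁ B₂ : X →ₗ[𝕜] Y) {a da b db : ℝ} (ha : 0 ≤ a) (hda : 0 ≤ da)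
    (hA : ∀ y, ‖A₁ y‖ ≤ a * ‖y‖) (hdA : ∀ y, ‖A₁ y - A₂ y‖ ≤ da * ‖y‖) (hB : ∀ x, ‖B₂ x‖ ≤ b * ‖x‖)
    (hdB : ∀ x, ‖B₁ x - B₂ x‖ ≤ db * ‖x‖) (x : X) : ‖A₁ (B₁ x) - A₂ (B₂ x)‖ ≤ (a * db + da * b) * ‖x‖ := by
  have hsplit : A₁ (B₁ x) - A₂ (B₂ x) = A₁ (B₁ x - B₂ x) + (A₁ (B₂ x) - A₂ (B₂ x)) := by rw [map_sub]; abel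
  rw [hsplit]
  calc ‖A₁ (B₁ x - B₂ x) + (A₁ (B₂ x) - A₂ (B₂ x))‖ ≤ ‖A₁ (B₁ x - B₂ x)‖ + ‖A₁ (B₂ x) - A₂ (B₂ x)‖ := norm_add_le _ _
    _ ≤ a * (db * ‖x‖) + da * (b * ‖x‖) :=
        add_le_add ((hA _).trans (mul_le_mul_of_nonneg_left (hdB x) ha)) ((hdA _).trans (mul_le_mul_of_nonneg_left (hB x) hda))
    _ = (a * db + da * b) * ‖x‖ := by ring

end Comp

/-! ## §2 Two resolvent systems: `K′ = Q′G′²Q′†`, `(Q′G′²Q′†)⁻¹` and `R = I − G′Q′†(Q′G′²Q′†)⁻¹Q′G′` are close -/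

section TwoSystems

variable {𝕜 : Type*} [RCLike 𝕜] {E : Type*} [NormedAddCommGroup E] [InnerProductSpace 𝕜 E] [FiniteDimensional 𝕜 E]
  {F : Type*} [NormedAddCommGroup F] [InnerProductSpace 𝕜 F] [FiniteDimensional 𝕜 F]
  {T₁ T₂ : E →ₗ[𝕜] E} (h₁ : ∀ x : E, x ≠ 0 → 0 < RCLike.re ⟪x, T₁ x⟫_𝕜) (h₂ : ∀ x : E, x ≠ 0 → 0 < RCLike.re ⟪x, T₂ x⟫_𝕜)
  {q₁ q₂ : E →ₗ[𝕜] F} {γ MQ θG θQ κ : ℝ} (hγ : 0 < γ) (hMQ : 0 ≤ MQ) (hθG : 0 ≤ θG) (hθQ : 0 ≤ θQ) (hκ : 0 < κ)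
  (hc₁ : ∀ x : E, γ * ‖x‖ ^ 2 ≤ RCLike.re ⟪x, T₁ x⟫_𝕜) (hc₂ : ∀ x : E, γ * ‖x‖ ^ 2 ≤ RCLike.re ⟪x, T₂ x⟫_𝕜)
  (hdG : ∀ x : E, ‖greenK T₁ h₁ x - greenK T₂ h₂ x‖ ≤ θG * ‖x‖)
  (hq₁ : ∀ x : E, ‖q₁ x‖ ≤ MQ * ‖x‖) (hq₂ : ∀ x : E, ‖q₂ x‖ ≤ MQ * ‖x‖) (hdq : ∀ x : E, ‖q₁ x - q₂ x‖ ≤ θQ * ‖x‖)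
  (hK₁ : ∀ y : F, y ≠ 0 → 0 < RCLike.re ⟪y, (q₁ ∘ₗ greenK T₁ h₁ ∘ₗ greenK T₁ h₁ ∘ₗ LinearMap.adjoint q₁) y⟫_𝕜)
  (hK₂ : ∀ y : F, y ≠ 0 → 0 < RCLike.re ⟪y, (q₂ ∘ₗ greenK T₂ h₂ ∘ₗ greenK T₂ h₂ ∘ₗ LinearMap.adjoint q₂) y⟫_𝕜)
  (hκ₁ : ∀ y : F, κ * ‖y‖ ^ 2 ≤ RCLike.re ⟪y, (q₁ ∘ₗ greenK T₁ h₁ ∘ₗ greenK T₁ h₁ ∘ₗ LinearMap.adjoint q₁) y⟫_𝕜)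
  (hκ₂ : ∀ y : F, κ * ‖y‖ ^ 2 ≤ RCLike.re ⟪y, (q₂ ∘ₗ greenK T₂ h₂ ∘ₗ greenK T₂ h₂ ∘ₗ LinearMap.adjoint q₂) y⟫_𝕜)

include hγ hMQ hθG hθQ hc₁ hc₂ hdG hq₁ hq₂ hdq in
/-- **`K′ = Q′G′²Q′†` OF TWO SYSTEMS ARE CLOSE**: `‖K′₁y − K′₂y‖ ≤ δ_K·‖y‖`, `δ_K = M_Q·(γ⁻¹(γ⁻¹θ_Q + θ_GM_Q) + θ_Gγ⁻¹M_Q) + θ_Q·γ⁻¹γ⁻¹M_Q` — four-factor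
telescoping with `‖G′_i‖ ≤ γ⁻¹` (`B9Eq3126GreenLetters.norm_greenK_le`), `‖Q′_i†‖ ≤ M_Q`, `‖Q′₁† − Q′₂†‖ ≤ θ_Q` (adjoint transfer). [cite: Balaban1985BackgroundPropagators, (3.65)–(3.67) p.403, (3.25) p.394] -/
theorem norm_Kp_sub_Kp_le (y : F) :
    ‖(q₁ ∘ₗ greenK T₁ h₁ ∘ₗ greenK T₁ h₁ ∘ₗ LinearMap.adjoint q₁) y - (q₂ ∘ₗ greenK T₂ h₂ ∘ₗ greenK T₂ h₂ ∘ₗ LinearMap.adjoint q₂) y‖ ≤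
      (MQ * (γ⁻¹ * (γ⁻¹ * θQ + θG * MQ) + θG * (γ⁻¹ * MQ)) + θQ * (γ⁻¹ * (γ⁻¹ * MQ))) * ‖y‖ := by
  have hG₁ : ∀ z, ‖greenK T₁ h₁ z‖ ≤ γ⁻¹ * ‖z‖ := norm_greenK_le hγ hc₁ h₁
  have hG₂ : ∀ z, ‖greenK T₂ h₂ z‖ ≤ γ⁻¹ * ‖z‖ := norm_greenK_le hγ hc₂ h₂
  have hQa₂ : ∀ y, ‖LinearMap.adjoint q₂ y‖ ≤ MQ * ‖y‖ := norm_adjoint_apply_le q₂ hMQ hq₂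
  have hQad : ∀ y, ‖LinearMap.adjoint q₁ y - LinearMap.adjoint q₂ y‖ ≤ θQ * ‖y‖ := fun y => by
    rw [← norm_neg, neg_sub]; exact norm_adjoint_sub_le hθQ (fun x => by rw [← norm_neg, neg_sub]; exact hdq x) y
  have hγ0 : 0 ≤ γ⁻¹ := by positivity
  -- `G′ ∘ Q′†`
  have hB : ∀ y, ‖greenK T₂ h₂ (LinearMap.adjoint q₂ y)‖ ≤ γ⁻¹ * MQ * ‖y‖ := norm_comp_le' _ _ hγ0 hG₂ hQa₂
  have hdB : ∀ y, ‖greenK T₁ h₁ (LinearMap.adjoint q₁ y) - greenK T₂ h₂ (LinearMap.adjoint q₂ y)‖ ≤ (γ⁻¹ * θQ + θG * MQ) * ‖y‖ :=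
    norm_comp_sub_comp_le _ _ _ _ hγ0 hθG hG₁ hdG hQa₂ hQad
  -- `G′ ∘ G′ ∘ Q′†`
  have hC : ∀ y, ‖greenK T₂ h₂ (greenK T₂ h₂ (LinearMap.adjoint q₂ y))‖ ≤ γ⁻¹ * (γ⁻¹ * MQ) * ‖y‖ :=
    norm_comp_le' _ (greenK T₂ h₂ ∘ₗ LinearMap.adjoint q₂) hγ0 hG₂ hB
  have hdC : ∀ y, ‖greenK T₁ h₁ (greenK T₁ h₁ (LinearMap.adjoint q₁ y)) - greenK T₂ h₂ (greenK T₂ h₂ (LinearMap.adjoint q₂ y))‖ ≤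
      (γ⁻¹ * (γ⁻¹ * θQ + θG * MQ) + θG * (γ⁻¹ * MQ)) * ‖y‖ :=
    norm_comp_sub_comp_le _ _ (greenK T₁ h₁ ∘ₗ LinearMap.adjoint q₁) (greenK T₂ h₂ ∘ₗ LinearMap.adjoint q₂) hγ0 hθG hG₁ hdG hB hdB
  -- `Q′ ∘ G′ ∘ G′ ∘ Q′†`
  have h := norm_comp_sub_comp_le q₁ q₂ (greenK T₁ h₁ ∘ₗ greenK T₁ h₁ ∘ₗ LinearMap.adjoint q₁)
    (greenK T₂ h₂ ∘ₗ greenK T₂ h₂ ∘ₗ LinearMap.adjoint q₂) hMQ hθQ hq₁ hdq hC hdC y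
  simpa only [LinearMap.comp_apply] using h

include hκ hκ₁ in
/-- `‖(Q′G′²Q′†)⁻¹‖ ≤ κ⁻¹` from the DISPLAYED coercivity `κ` of `K′` (the route's S3c letter; NOT derived from `‖Δ′_a‖`). [cite: Balaban1985BackgroundPropagators, (3.65) p.403, Thm 3.11 p.416] -/
theorem norm_cinv_le (y : F) : ‖greenK _ hK₁ y‖ ≤ κ⁻¹ * ‖y‖ := norm_greenK_le hκ hκ₁ hK₁ y

include hγ hMQ hθG hθQ hc₁ hc₂ hdG hq₁ hq₂ hdq hκ hκ₁ hκ₂ in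
/-- **`(Q′G′²Q′†)⁻¹` OF TWO SYSTEMS ARE CLOSE**: `‖c₁y − c₂y‖ ≤ κ⁻¹·δ_K·κ⁻¹·‖y‖` — the resolvent step (`B9Eq386ResolventLetters.norm_greenK_sub_greenK_le`)
at `norm_Kp_sub_Kp_le`; print's (3.65)–(3.67) «(Q′G′(U′U)²Q′*)⁻¹ = (Q′G′(U)²Q′*)⁻¹(I − V′₂(A)(Q′G′(U)²Q′*)⁻¹)⁻¹» in `L²` operator norm.
[cite: Balaban1985BackgroundPropagators, (3.65)–(3.67) p.403] -/
theorem norm_cinv_sub_cinv_le (y : F) :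
    ‖greenK _ hK₁ y - greenK _ hK₂ y‖ ≤
      κ⁻¹ * (MQ * (γ⁻¹ * (γ⁻¹ * θQ + θG * MQ) + θG * (γ⁻¹ * MQ)) + θQ * (γ⁻¹ * (γ⁻¹ * MQ))) * κ⁻¹ * ‖y‖ :=
  norm_greenK_sub_greenK_le hκ hκ hκ₁ hκ₂ hK₁ hK₂ (by positivity) (fun y => by
    rw [← norm_neg, neg_sub]; exact norm_Kp_sub_Kp_le h₁ h₂ hγ hMQ hθG hθQ hc₁ hc₂ hdG hq₁ hq₂ hdq y) y

include hγ hMQ hθG hθQ hc₁ hc₂ hdG hq₁ hq₂ hdq hκ hκ₁ hκ₂ in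
/-- **THE GAUGE-FIXING PROJECTIONS OF TWO SYSTEMS ARE CLOSE** (p. 403 «R(U), P(U) = I − R(U) … satisfy the same bounds», assembled through
(3.25)): with `G′_i = (Δ′_i)⁻¹`, `c_i = (Q′_iG′_i²Q′_i†)⁻¹`,
`‖(f − G′₁Q′₁†c₁Q′₁G′₁f) − (f − G′₂Q′₂†c₂Q′₂G′₂f)‖ ≤ C_R♯·‖f‖`, `C_R♯ = γ⁻¹·d₄ + θ_G·(M_Qκ⁻¹M_Qγ⁻¹)` where `d₁ = M_Qθ_G + θ_Qγ⁻¹`,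
`d₂ = κ⁻¹d₁ + (κ⁻¹δ_Kκ⁻¹)(M_Qγ⁻¹)`, `d₃ = M_Qd₂ + θ_Q(κ⁻¹M_Qγ⁻¹)`, `d₄ = d₃` read along `Q′†` — five-factor telescoping by §1 from the DISPLAYED
letters `γ` (coercivity of `Δ′_i`), `θ_G`, `M_Q`, `θ_Q`, `κ` (coercivity of `K′_i`); first order in `(θ_G, θ_Q)`.
[cite: Balaban1985BackgroundPropagators, p.403, (3.25) p.394, (3.63)–(3.68) pp.402–403] -/
theorem norm_R_sub_R_le (f : E) :
    ‖(f - greenK T₁ h₁ (LinearMap.adjoint q₁ (greenK _ hK₁ (q₁ (greenK T₁ h₁ f))))) -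
        (f - greenK T₂ h₂ (LinearMap.adjoint q₂ (greenK _ hK₂ (q₂ (greenK T₂ h₂ f)))))‖ ≤
      (γ⁻¹ * (MQ * (κ⁻¹ * (MQ * θG + θQ * γ⁻¹) +
          κ⁻¹ * (MQ * (γ⁻¹ * (γ⁻¹ * θQ + θG * MQ) + θG * (γ⁻¹ * MQ)) + θQ * (γ⁻¹ * (γ⁻¹ * MQ))) * κ⁻¹ * (MQ * γ⁻¹)) +
          θQ * (κ⁻¹ * (MQ * γ⁻¹))) +
        θG * (MQ * (κ⁻¹ * (MQ * γ⁻¹)))) * ‖f‖ := by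
  have hG₁ : ∀ z, ‖greenK T₁ h₁ z‖ ≤ γ⁻¹ * ‖z‖ := norm_greenK_le hγ hc₁ h₁
  have hG₂ : ∀ z, ‖greenK T₂ h₂ z‖ ≤ γ⁻¹ * ‖z‖ := norm_greenK_le hγ hc₂ h₂
  have hQa₁ : ∀ y, ‖LinearMap.adjoint q₁ y‖ ≤ MQ * ‖y‖ := norm_adjoint_apply_le q₁ hMQ hq₁
  have hQad : ∀ y, ‖LinearMap.adjoint q₁ y - LinearMap.adjoint q₂ y‖ ≤ θQ * ‖y‖ := fun y => by
    rw [← norm_neg, neg_sub]; exact norm_adjoint_sub_le hθQ (fun x => by rw [← norm_neg, neg_sub]; exact hdq x) y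
  have hc₂' : ∀ y, ‖greenK _ hK₂ y‖ ≤ κ⁻¹ * ‖y‖ := norm_greenK_le hκ hκ₂ hK₂
  have hc₁' : ∀ y, ‖greenK _ hK₁ y‖ ≤ κ⁻¹ * ‖y‖ := norm_greenK_le hκ hκ₁ hK₁
  have hdc := norm_cinv_sub_cinv_le h₁ h₂ hγ hMQ hθG hθQ hκ hc₁ hc₂ hdG hq₁ hq₂ hdq hK₁ hK₂ hκ₁ hκ₂
  have hγ0 : 0 ≤ γ⁻¹ := by positivity
  have hκ0 : 0 ≤ κ⁻¹ := by positivity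
  set δK : ℝ := MQ * (γ⁻¹ * (γ⁻¹ * θQ + θG * MQ) + θG * (γ⁻¹ * MQ)) + θQ * (γ⁻¹ * (γ⁻¹ * MQ)) with hδK
  -- stage 1: `Q′ ∘ G′`
  have hB : ∀ x, ‖q₂ (greenK T₂ h₂ x)‖ ≤ MQ * γ⁻¹ * ‖x‖ := norm_comp_le' _ _ hMQ hq₂ hG₂
  have hdB : ∀ x, ‖q₁ (greenK T₁ h₁ x) - q₂ (greenK T₂ h₂ x)‖ ≤ (MQ * θG + θQ * γ⁻¹) * ‖x‖ :=
    norm_comp_sub_comp_le _ _ _ _ hMQ hθQ hq₁ hdq hG₂ hdG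
  -- stage 2: `c ∘ Q′ ∘ G′`
  have hC : ∀ x, ‖greenK _ hK₂ (q₂ (greenK T₂ h₂ x))‖ ≤ κ⁻¹ * (MQ * γ⁻¹) * ‖x‖ :=
    norm_comp_le' _ (q₂ ∘ₗ greenK T₂ h₂) hκ0 hc₂' hB
  have hdC : ∀ x, ‖greenK _ hK₁ (q₁ (greenK T₁ h₁ x)) - greenK _ hK₂ (q₂ (greenK T₂ h₂ x))‖ ≤
      (κ⁻¹ * (MQ * θG + θQ * γ⁻¹) + κ⁻¹ * δK * κ⁻¹ * (MQ * γ⁻¹)) * ‖x‖ :=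
    norm_comp_sub_comp_le _ _ (q₁ ∘ₗ greenK T₁ h₁) (q₂ ∘ₗ greenK T₂ h₂) hκ0 (by positivity) hc₁' hdc hB hdB
  -- stage 3: `Q′† ∘ c ∘ Q′ ∘ G′`
  have hD : ∀ x, ‖LinearMap.adjoint q₂ (greenK _ hK₂ (q₂ (greenK T₂ h₂ x)))‖ ≤ MQ * (κ⁻¹ * (MQ * γ⁻¹)) * ‖x‖ :=
    norm_comp_le' _ (greenK _ hK₂ ∘ₗ q₂ ∘ₗ greenK T₂ h₂) hMQ (norm_adjoint_apply_le q₂ hMQ hq₂) hC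
  have hdD : ∀ x, ‖LinearMap.adjoint q₁ (greenK _ hK₁ (q₁ (greenK T₁ h₁ x))) -
      LinearMap.adjoint q₂ (greenK _ hK₂ (q₂ (greenK T₂ h₂ x)))‖ ≤
      (MQ * (κ⁻¹ * (MQ * θG + θQ * γ⁻¹) + κ⁻¹ * δK * κ⁻¹ * (MQ * γ⁻¹)) + θQ * (κ⁻¹ * (MQ * γ⁻¹))) * ‖x‖ :=
    norm_comp_sub_comp_le _ _ (greenK _ hK₁ ∘ₗ q₁ ∘ₗ greenK T₁ h₁) (greenK _ hK₂ ∘ₗ q₂ ∘ₗ greenK T₂ h₂) hMQ hθQ hQa₁ hQad hC hdC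
  -- stage 4: `G′ ∘ Q′† ∘ c ∘ Q′ ∘ G′`
  have hdE := norm_comp_sub_comp_le (greenK T₁ h₁) (greenK T₂ h₂)
    (LinearMap.adjoint q₁ ∘ₗ greenK _ hK₁ ∘ₗ q₁ ∘ₗ greenK T₁ h₁) (LinearMap.adjoint q₂ ∘ₗ greenK _ hK₂ ∘ₗ q₂ ∘ₗ greenK T₂ h₂)
    hγ0 hθG hG₁ hdG hD hdD f
  simp only [LinearMap.comp_apply] at hdE
  rw [sub_sub_sub_cancel_left, ← norm_neg, neg_sub]
  refine hdE.trans (le_of_eq ?_)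
  rw [hδK]

end TwoSystems

/-! ## §3 At the chain's `R(U)`: two backgrounds -/

section Chain

variable {d : ℕ} (L : ℕ) [NeZero L] (m : Fin d → ℕ) {𝔸 : Type*} [Ring 𝔸] [StarRing 𝔸] [Algebra ℂ 𝔸] [StarModule ℂ 𝔸]
  {W : Type*} [NormedAddCommGroup W] [InnerProductSpace ℂ W] [FiniteDimensional ℂ W] (φ : W ≃ₗ[ℂ] 𝔸) (c₀ : ℝ) [Fact (0 < c₀)]
  (η : ℝ) (U₁ U₂ : Bond d (fineP L m) → 𝔸ˣ) (c₁ : ℝ) [Fact (0 < c₁)] (a' : ℝ)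
  (hRS₁ : ∀ (b : Bond d (fineP L m)) (v u : W), ⟪adTransportW φ U₁ b v, u⟫_ℂ = ⟪v, adTransportW φ (fun b => (U₁ b)⁻¹) b u⟫_ℂ)
  (hRS₂ : ∀ (b : Bond d (fineP L m)) (v u : W), ⟪adTransportW φ U₂ b v, u⟫_ℂ = ⟪v, adTransportW φ (fun b => (U₂ b)⁻¹) b u⟫_ℂ)
  (hpos₁ : ∀ x : SiteL2K ℂ d (fineP L m) c₀ W, x ≠ 0 → 0 < RCLike.re ⟪x, laplacePrimeA L m φ η U₁ a' (c₁ := c₁) x⟫_ℂ)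
  (hpos₂ : ∀ x : SiteL2K ℂ d (fineP L m) c₀ W, x ≠ 0 → 0 < RCLike.re ⟪x, laplacePrimeA L m φ η U₂ a' (c₁ := c₁) x⟫_ℂ)
  {γ MQ θG θQ κ : ℝ} (hγ : 0 < γ) (hMQ : 0 ≤ MQ) (hθG : 0 ≤ θG) (hθQ : 0 ≤ θQ) (hκ : 0 < κ)
  (hc₁ : ∀ x, γ * ‖x‖ ^ 2 ≤ RCLike.re ⟪x, laplacePrimeA L m φ η U₁ a' (c₀ := c₀) (c₁ := c₁) x⟫_ℂ)
  (hc₂ : ∀ x, γ * ‖x‖ ^ 2 ≤ RCLike.re ⟪x, laplacePrimeA L m φ η U₂ a' (c₀ := c₀) (c₁ := c₁) x⟫_ℂ)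
  (hdG : ∀ x, ‖GpOfU L m φ η U₁ a' (c₁ := c₁) hpos₁ x - GpOfU L m φ η U₂ a' (c₁ := c₁) hpos₂ x‖ ≤ θG * ‖x‖)
  (hq₁ : ∀ x, ‖((WL2.linearEquiv ℂ ℂ (fun _ : TSite d m => c₁)).symm.toLinearMap ∘ₗ QprimeW L m φ U₁ (c₀ := c₀)) x‖ ≤ MQ * ‖x‖)
  (hq₂ : ∀ x, ‖((WL2.linearEquiv ℂ ℂ (fun _ : TSite d m => c₁)).symm.toLinearMap ∘ₗ QprimeW L m φ U₂ (c₀ := c₀)) x‖ ≤ MQ * ‖x‖)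
  (hdq : ∀ x, ‖((WL2.linearEquiv ℂ ℂ (fun _ : TSite d m => c₁)).symm.toLinearMap ∘ₗ QprimeW L m φ U₁ (c₀ := c₀)) x -
    ((WL2.linearEquiv ℂ ℂ (fun _ : TSite d m => c₁)).symm.toLinearMap ∘ₗ QprimeW L m φ U₂ (c₀ := c₀)) x‖ ≤ θQ * ‖x‖)
  (hκ₁ : ∀ y : SiteL2K ℂ d m c₁ W, κ * ‖y‖ ^ 2 ≤ RCLike.re ⟪y,
    (((WL2.linearEquiv ℂ ℂ (fun _ : TSite d m => c₁)).symm.toLinearMap ∘ₗ QprimeW L m φ U₁ (c₀ := c₀)) ∘ₗ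
      GpOfU L m φ η U₁ a' (c₁ := c₁) hpos₁ ∘ₗ GpOfU L m φ η U₁ a' (c₁ := c₁) hpos₁ ∘ₗ
        LinearMap.adjoint ((WL2.linearEquiv ℂ ℂ (fun _ : TSite d m => c₁)).symm.toLinearMap ∘ₗ QprimeW L m φ U₁ (c₀ := c₀))) y⟫_ℂ)
  (hκ₂ : ∀ y : SiteL2K ℂ d m c₁ W, κ * ‖y‖ ^ 2 ≤ RCLike.re ⟪y,
    (((WL2.linearEquiv ℂ ℂ (fun _ : TSite d m => c₁)).symm.toLinearMap ∘ₗ QprimeW L m φ U₂ (c₀ := c₀)) ∘ₗ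
      GpOfU L m φ η U₂ a' (c₁ := c₁) hpos₂ ∘ₗ GpOfU L m φ η U₂ a' (c₁ := c₁) hpos₂ ∘ₗ
        LinearMap.adjoint ((WL2.linearEquiv ℂ ℂ (fun _ : TSite d m => c₁)).symm.toLinearMap ∘ₗ QprimeW L m φ U₂ (c₀ := c₀))) y⟫_ℂ)

omit [StarRing 𝔸] [StarModule ℂ 𝔸] in
include hRS₁ hRS₂ hγ hMQ hθG hθQ hκ hc₁ hc₂ hdG hq₁ hq₂ hdq hκ₁ hκ₂ in
/-- **`‖R(U₁)f − R(U₂)f‖ ≤ C_R♯·‖f‖` FOR THE CHAIN'S GAUGE-FIXING PROJECTIONS** (`B9Eq326OperatorAssembly.RofU`) of two backgrounds with mutually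
adjoint transporters and positive `Δ′_a(U_i)`, from the five DISPLAYED letters — `γ` (coercivity of `Δ′_a(U_i)`), `θ_G` (`‖G′(U₁) − G′(U₂)‖`), `M_Q`,
`θ_Q` (the `Q′(U_i)` read into the weight-`c₁` carrier of the unit lattice and their difference), `κ` (coercivity of `Q′G′(U_i)²Q′†`) — through (3.25)
(`B9Eq325ProjFormula.RofU_eq_formula`) and §2; `C_R♯` as displayed in `norm_R_sub_R_le`.  The route R2′ STEP B7′ supplies the letters η-free
(S3b, S3c, (ρ′)); this file does not. [cite: Balaban1985BackgroundPropagators, p.403, (3.25) p.394] -/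
theorem norm_RofU_sub_RofU_le (f : SiteL2K ℂ d (fineP L m) c₀ W) :
    ‖RofU L m φ η U₁ (c₀ := c₀) f - RofU L m φ η U₂ (c₀ := c₀) f‖ ≤
      (γ⁻¹ * (MQ * (κ⁻¹ * (MQ * θG + θQ * γ⁻¹) +
          κ⁻¹ * (MQ * (γ⁻¹ * (γ⁻¹ * θQ + θG * MQ) + θG * (γ⁻¹ * MQ)) + θQ * (γ⁻¹ * (γ⁻¹ * MQ))) * κ⁻¹ * (MQ * γ⁻¹)) +
          θQ * (κ⁻¹ * (MQ * γ⁻¹))) +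
        θG * (MQ * (κ⁻¹ * (MQ * γ⁻¹)))) * ‖f‖ := by
  rw [RofU_eq_formula L m φ c₀ η U₁ c₁ a' hRS₁ hpos₁ f, RofU_eq_formula L m φ c₀ η U₂ c₁ a' hRS₂ hpos₂ f]
  unfold GpOfU
  exact norm_R_sub_R_le _ _ hγ hMQ hθG hθQ hκ hc₁ hc₂ hdG hq₁ hq₂ hdq
    (QGGQ_pos L m φ c₀ η U₁ c₁ a' hRS₁ hpos₁) (QGGQ_pos L m φ c₀ η U₂ c₁ a' hRS₂ hpos₂) hκ₁ hκ₂ f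

end Chain

/-! ## §4 The letter `θ_Q` in the weight-`c₁` currency from NE9 leaf-03's Hilbert-currency (ρ′)₂ -/

section ThetaQ

variable {d : ℕ} (L : ℕ) [NeZero L] (m : Fin d → ℕ) {𝔸 : Type*} [Ring 𝔸] [Algebra ℂ 𝔸]
  {W : Type*} [NormedAddCommGroup W] [InnerProductSpace ℂ W] (φ : W ≃ₗ[ℂ] 𝔸) (c₀ : ℝ) [Fact (0 < c₀)] (c₁ : ℝ) [Fact (0 < c₁)]
  (U U' : Bond d (fineP L m) → 𝔸ˣ) {ε δ : ℝ} (hε : 0 ≤ ε) (hδ : 0 ≤ δ)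
  (hR : ∀ b w, ‖adTransportW φ U b w - w‖ ≤ ε * ‖w‖) (hR' : ∀ b w, ‖adTransportW φ U' b w - w‖ ≤ ε * ‖w‖)
  (hRR' : ∀ b w, ‖adTransportW φ U b w - adTransportW φ U' b w‖ ≤ δ * ‖w‖)

include hε hδ hR hR' hRR' in
/-- **THE LETTER `θ_Q` OF §2–§3 IN THE WEIGHT-`c₁` CURRENCY**: `‖Q̃′(U)λ − Q̃′(U′)λ‖_{c₁} ≤ ρ′₂·√(c₁∕(L^d·c₀))·‖λ‖_{c₀}`,
`ρ′₂ = d(L−1)·δ·(1+ε)^{d(L−1)}` — NE9 leaf-03's two-background (ρ′) in Hilbert currency (`B9Eq319QprimeLipschitzTwoBackgrounds.sum_norm_sq_QprimeW_sub_QprimeW_le`: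
`Σ_y‖…‖² ≤ ρ′₂²(L^dc₀)⁻¹‖λ‖²`) read into the unit-lattice carrier `SiteL2K ℂ d m c₁ W` of `laplacePrimeA` (`WL2.norm_sq`); under the canonical weights
`c₁(ηL)² = c₀L^d` the factor `√(c₁∕(L^dc₀))` is `(ηL)⁻¹` — no `√(L^d)` (contrast the centre-lift currency of `B9Eq319CentreLiftL2TwoBackgrounds`).
[cite: Balaban1985BackgroundPropagators, (3.19) p.393, (3.11) p.392, p.403] -/
theorem norm_Qtilde_sub_Qtilde_le (lam : SiteL2K ℂ d (fineP L m) c₀ W) :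
    ‖((WL2.linearEquiv ℂ ℂ (fun _ : TSite d m => c₁)).symm.toLinearMap ∘ₗ QprimeW L m φ U (c₀ := c₀)) lam -
        ((WL2.linearEquiv ℂ ℂ (fun _ : TSite d m => c₁)).symm.toLinearMap ∘ₗ QprimeW L m φ U' (c₀ := c₀)) lam‖ ≤
      ((d * (L - 1) : ℕ) * δ * (1 + ε) ^ (d * (L - 1))) * Real.sqrt (c₁ / ((L : ℝ) ^ d * c₀)) * ‖lam‖ := by
  have hc₀ : 0 < c₀ := Fact.out
  have hc₁ : 0 < c₁ := Fact.out
  have hL0 : (0 : ℝ) < (L : ℝ) ^ d := pow_pos (Nat.cast_pos.2 (Nat.pos_of_ne_zero (NeZero.ne L))) d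
  have hρ := rho₂_nonneg L (d := d) hε hδ
  have hsum := sum_norm_sq_QprimeW_sub_QprimeW_le L m φ U U' (c₀ := c₀) hε hδ hR hR' hRR' lam
  simp only [LinearMap.comp_apply, LinearEquiv.coe_toLinearMap]
  rw [← map_sub]
  refine (pow_le_pow_iff_left₀ (norm_nonneg _) (by positivity) two_ne_zero).1 ?_
  rw [WL2.norm_sq]
  have hpt : ∀ y, c₁ * ‖WL2.equiv ℂ (fun _ : TSite d m => c₁) W ((WL2.linearEquiv ℂ ℂ (fun _ : TSite d m => c₁)).symm
      (QprimeW L m φ U (c₀ := c₀) lam - QprimeW L m φ U' (c₀ := c₀) lam)) y‖ ^ 2 =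
      c₁ * ‖QprimeW L m φ U (c₀ := c₀) lam y - QprimeW L m φ U' (c₀ := c₀) lam y‖ ^ 2 := fun y => rfl
  simp only [hpt, ← Finset.mul_sum]
  calc c₁ * ∑ y, ‖QprimeW L m φ U (c₀ := c₀) lam y - QprimeW L m φ U' (c₀ := c₀) lam y‖ ^ 2
      ≤ c₁ * (((d * (L - 1) : ℕ) * δ * (1 + ε) ^ (d * (L - 1))) ^ 2 * (((L : ℝ) ^ d * c₀)⁻¹ * ‖lam‖ ^ 2)) :=
        mul_le_mul_of_nonneg_left hsum hc₁.le
    _ = (((d * (L - 1) : ℕ) * δ * (1 + ε) ^ (d * (L - 1))) * Real.sqrt (c₁ / ((L : ℝ) ^ d * c₀)) * ‖lam‖) ^ 2 := by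
        have hs : Real.sqrt (c₁ / ((L : ℝ) ^ d * c₀)) ^ 2 = c₁ / ((L : ℝ) ^ d * c₀) := Real.sq_sqrt (by positivity)
        rw [show ((((d * (L - 1) : ℕ) : ℝ) * δ * (1 + ε) ^ (d * (L - 1))) * Real.sqrt (c₁ / ((L : ℝ) ^ d * c₀)) * ‖lam‖) ^ 2 =
            (((d * (L - 1) : ℕ) : ℝ) * δ * (1 + ε) ^ (d * (L - 1))) ^ 2 * Real.sqrt (c₁ / ((L : ℝ) ^ d * c₀)) ^ 2 * ‖lam‖ ^ 2 by ring,
          hs, div_eq_mul_inv]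
        ring

/-- **THE FLAT LETTER `M_Q(1)` IN THE WEIGHT-`c₁` CURRENCY**: `‖Q̃′(1)λ‖_{c₁} ≤ √(c₁∕(L^d·c₀))·‖λ‖_{c₀}` — `Q′(1)` is the block mean
(`B9Eq319QprimeLipschitz.QprimeW_one_apply`), Jensen on each block (`blockMean_norm_sq_le`) and the block partition (`sum_blockOf_sum`); `(ηL)⁻¹`
under the canonical weights — the `L²`-contraction reading of print's «Q′ … satisfy the same bounds» at the flat point, with no `√(L^d)`.
[cite: Balaban1985BackgroundPropagators, (3.19) p.393, (3.11) p.392; Balaban1985Averaging, (2) p.17] -/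
theorem norm_Qtilde_one_le (lam : SiteL2K ℂ d (fineP L m) c₀ W) :
    ‖((WL2.linearEquiv ℂ ℂ (fun _ : TSite d m => c₁)).symm.toLinearMap ∘ₗ
        QprimeW L m φ (fun _ : Bond d (fineP L m) => (1 : 𝔸ˣ)) (c₀ := c₀)) lam‖ ≤ Real.sqrt (c₁ / ((L : ℝ) ^ d * c₀)) * ‖lam‖ := by
  have hc₀ : 0 < c₀ := Fact.out
  have hc₁ : 0 < c₁ := Fact.out
  have hL0 : (0 : ℝ) < (L : ℝ) ^ d := pow_pos (Nat.cast_pos.2 (Nat.pos_of_ne_zero (NeZero.ne L))) d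
  set lt := WL2.linearEquiv ℂ ℂ (fun _ : TSite d (fineP L m) => c₀) lam with hlt
  -- Jensen per block
  have hy : ∀ y : TSite d m, ‖QprimeW L m φ (fun _ : Bond d (fineP L m) => (1 : 𝔸ˣ)) (c₀ := c₀) lam y‖ ^ 2 ≤
      ((L : ℝ) ^ d)⁻¹ * ∑ x ∈ B9Eq319QprimeTorus.blockOf L m y, ‖lt x‖ ^ 2 := by
    intro y
    rw [QprimeW_one_apply]
    have h1 : ‖∑ x ∈ B9Eq319QprimeTorus.blockOf L m y, ((L : ℝ) ^ d)⁻¹ • lt x‖ ≤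
        ((L : ℝ) ^ d)⁻¹ * ∑ x ∈ B9Eq319QprimeTorus.blockOf L m y, ‖lt x‖ := by
      rw [Finset.mul_sum]
      refine (norm_sum_le _ _).trans (Finset.sum_le_sum fun x _ => ?_)
      rw [norm_smul, Real.norm_of_nonneg (by positivity)]
    exact (pow_le_pow_left₀ (norm_nonneg _) h1 2).trans (blockMean_norm_sq_le L m lt y)
  -- sum over the blocks
  have hn : ‖lam‖ ^ 2 = c₀ * ∑ x, ‖lt x‖ ^ 2 := by rw [WL2.norm_sq, Finset.mul_sum]; rfl
  have hsumy : ∑ y, ‖QprimeW L m φ (fun _ : Bond d (fineP L m) => (1 : 𝔸ˣ)) (c₀ := c₀) lam y‖ ^ 2 ≤ ((L : ℝ) ^ d * c₀)⁻¹ * ‖lam‖ ^ 2 := by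
    calc ∑ y, ‖QprimeW L m φ (fun _ : Bond d (fineP L m) => (1 : 𝔸ˣ)) (c₀ := c₀) lam y‖ ^ 2
        ≤ ∑ y, ((L : ℝ) ^ d)⁻¹ * ∑ x ∈ B9Eq319QprimeTorus.blockOf L m y, ‖lt x‖ ^ 2 := Finset.sum_le_sum fun y _ => hy y
      _ = ((L : ℝ) ^ d)⁻¹ * ∑ x, ‖lt x‖ ^ 2 := by rw [← Finset.mul_sum, sum_blockOf_sum]
      _ = ((L : ℝ) ^ d * c₀)⁻¹ * ‖lam‖ ^ 2 := by rw [hn, mul_inv, mul_assoc, inv_mul_cancel_left₀ hc₀.ne']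
  -- read into the `c₁` carrier
  simp only [LinearMap.comp_apply, LinearEquiv.coe_toLinearMap]
  refine (pow_le_pow_iff_left₀ (norm_nonneg _) (by positivity) two_ne_zero).1 ?_
  rw [WL2.norm_sq]
  have hpt : ∀ y, c₁ * ‖WL2.equiv ℂ (fun _ : TSite d m => c₁) W ((WL2.linearEquiv ℂ ℂ (fun _ : TSite d m => c₁)).symm
      (QprimeW L m φ (fun _ : Bond d (fineP L m) => (1 : 𝔸ˣ)) (c₀ := c₀) lam)) y‖ ^ 2 =
      c₁ * ‖QprimeW L m φ (fun _ : Bond d (fineP L m) => (1 : 𝔸ˣ)) (c₀ := c₀) lam y‖ ^ 2 := fun y => rfl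
  simp only [hpt, ← Finset.mul_sum]
  calc c₁ * ∑ y, ‖QprimeW L m φ (fun _ : Bond d (fineP L m) => (1 : 𝔸ˣ)) (c₀ := c₀) lam y‖ ^ 2 ≤ c₁ * (((L : ℝ) ^ d * c₀)⁻¹ * ‖lam‖ ^ 2) :=
        mul_le_mul_of_nonneg_left hsumy hc₁.le
    _ = (Real.sqrt (c₁ / ((L : ℝ) ^ d * c₀)) * ‖lam‖) ^ 2 := by
        rw [mul_pow, Real.sq_sqrt (by positivity), div_eq_mul_inv]
        ring

include hε hR in
/-- **THE LETTER `M_Q(U)` IN THE WEIGHT-`c₁` CURRENCY**: `‖Q̃′(U)λ‖_{c₁} ≤ (1 + d(L−1)·ε·(1+ε)^{d(L−1)})·√(c₁∕(L^d·c₀))·‖λ‖_{c₀}` for transporters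
`ε`-close to the identity — the flat letter plus §4's two-background letter at `U′ ≡ 1` (`δ = ε`); `(ηL)⁻¹(1 + O(ε·dL))` under the canonical weights.
[cite: Balaban1985BackgroundPropagators, (3.19) p.393, p.403] -/
theorem norm_Qtilde_le (lam : SiteL2K ℂ d (fineP L m) c₀ W) :
    ‖((WL2.linearEquiv ℂ ℂ (fun _ : TSite d m => c₁)).symm.toLinearMap ∘ₗ QprimeW L m φ U (c₀ := c₀)) lam‖ ≤
      (1 + (d * (L - 1) : ℕ) * ε * (1 + ε) ^ (d * (L - 1))) * Real.sqrt (c₁ / ((L : ℝ) ^ d * c₀)) * ‖lam‖ := by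
  have h1 : ∀ (b : Bond d (fineP L m)) (w : W), adTransportW φ (fun _ : Bond d (fineP L m) => (1 : 𝔸ˣ)) b w = w := fun b w => by
    rw [adTransportW_one]; rfl
  have hR' : ∀ (b : Bond d (fineP L m)) (w : W), ‖adTransportW φ (fun _ : Bond d (fineP L m) => (1 : 𝔸ˣ)) b w - w‖ ≤ ε * ‖w‖ :=
    fun b w => by rw [h1, sub_self, norm_zero]; positivity
  have hRR' : ∀ (b : Bond d (fineP L m)) (w : W),
      ‖adTransportW φ U b w - adTransportW φ (fun _ : Bond d (fineP L m) => (1 : 𝔸ˣ)) b w‖ ≤ ε * ‖w‖ := fun b w => by rw [h1]; exact hR b w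
  have hd := norm_Qtilde_sub_Qtilde_le L m φ c₀ c₁ U (fun _ : Bond d (fineP L m) => (1 : 𝔸ˣ)) hε hε hR hR' hRR' lam
  have hf := norm_Qtilde_one_le L m φ c₀ c₁ lam
  have hsplit : ((WL2.linearEquiv ℂ ℂ (fun _ : TSite d m => c₁)).symm.toLinearMap ∘ₗ QprimeW L m φ U (c₀ := c₀)) lam =
      (((WL2.linearEquiv ℂ ℂ (fun _ : TSite d m => c₁)).symm.toLinearMap ∘ₗ QprimeW L m φ U (c₀ := c₀)) lam -
        ((WL2.linearEquiv ℂ ℂ (fun _ : TSite d m => c₁)).symm.toLinearMap ∘ₗ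
          QprimeW L m φ (fun _ : Bond d (fineP L m) => (1 : 𝔸ˣ)) (c₀ := c₀)) lam) +
      ((WL2.linearEquiv ℂ ℂ (fun _ : TSite d m => c₁)).symm.toLinearMap ∘ₗ
          QprimeW L m φ (fun _ : Bond d (fineP L m) => (1 : 𝔸ˣ)) (c₀ := c₀)) lam := by abel
  rw [hsplit]
  refine (norm_add_le _ _).trans ?_
  calc _ ≤ ((d * (L - 1) : ℕ) * ε * (1 + ε) ^ (d * (L - 1))) * Real.sqrt (c₁ / ((L : ℝ) ^ d * c₀)) * ‖lam‖ +
        Real.sqrt (c₁ / ((L : ℝ) ^ d * c₀)) * ‖lam‖ := add_le_add hd hf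
    _ = (1 + (d * (L - 1) : ℕ) * ε * (1 + ε) ^ (d * (L - 1))) * Real.sqrt (c₁ / ((L : ℝ) ^ d * c₀)) * ‖lam‖ := by ring

end ThetaQ

end Literature.MathematicalPhysics.QuantumFieldTheory.Balaban1983to89.B9Eq325RLipschitzResolvent

end
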